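import Literature.NumberTheory.EllipticCurves.HeegnerPointsKolyvaginPrimaryCebotarevProofs
import Literature.NumberTheory.EllipticCurves.HeegnerPointsKolyvaginPrimaryCongruenceProofs
import Literature.NumberTheory.EllipticCurves.SupersingularDensitySerreTraceProofs
import Literature.NumberTheory.EllipticCurves.BSDConductorProofs
import Literature.NumberTheory.EllipticCurves.WeilPairingProofs
import Literature.NumberTheory.Automorphic.ChebotarevArtinRepHolds
import Literature.NumberTheory.GaloisRepresentations.FrobeniusDensity
import HarnessLib

/-!
# Route `AdditiveKolyvaginRoad`, crux KS′ `LevelKolyvaginSystemsAdditive` (item stmt-BirchSwinnertonDyer-21396): KURIHARA PRIMES EXIST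
# ABOVE EVERY BOUND — the non-vacuity brick of crux card `kurihara-lower-half` (`IsKuriharaLevel`), UNCONDITIONAL, for EVERY curve
# (cell `pub/bsd-wall`, width seat `bsd-wall-akr-p2x-w4` g6; `--supports stmt-BirchSwinnertonDyer-21396`, helper)

THEOREMS ONLY (no definition, no named fact, no `sorry`).  BSD is not proved by any of this; nothing about Kurihara NUMBERS is claimed.

THE POINT.  The card `Cruxes/LevelKolyvaginSystemsAdditive/Ideas/kurihara-lower-half.md` (crux-ideate r1 seat 2 g19) runs Kim–Nakamura's
criterion over KURIHARA LEVELS: square-free `n > 1` all of whose primes `ℓ` satisfy `ℓ ∤ N_E`, `ℓ ≠ p`, `ℓ ≡ 1 (mod p)`,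
`a_ℓ(E) ≡ ℓ + 1 (mod p)` (sketch `RamifiedHabitatKuriharaSlotSketch.lean` §2, `KuriharaLowerHalf.IsKuriharaLevel`); its residual C⁺
(`KuriharaNonvanishingRankZeroAdditive`) asserts the EXISTENCE of such a level with a unit Kurihara number, and its barrier note says
«Kurihara primes … exist in positive density by Chebotarev — no admissibility famine».  This file makes the supply a tree theorem,
with NO hypothesis on the image of `ρ̄_{E,p}` (the Frobenius class used is the IDENTITY of `Gal(ℚ(E[p])/ℚ)`, which every image has):

* `exists_kuriharaPrime_gt` — for every elliptic `W/ℚ` in global minimal form, every prime `p` and every bound `b` there is a prime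
  `ℓ > b` with `ℓ ∤ N_W`, `ℓ ≠ p`, `p ∣ ℓ − 1` and `p ∣ a_ℓ(W) − (ℓ + 1)` (the four clauses of `IsKuriharaLevel` VERBATIM).  Proof:
  Čebotarev (tree theorem `absoluteGaloisGroup.frobenius_dense` with `chebotarev_artinRep_holds`) gives an arithmetic Frobenius `σ` at a
  prime above some `ℓ > max(b, N, p)` inside the open subgroup `Γ_{ℚ(E[p])}` (`torsionFixing`, `isOpen_torsionFixing`); `σ` acts as
  the identity on the `𝔽_p`-plane `E[p]`, so `a_ℓ ≡ tr ρ̄(σ) = 2 (mod p)` (`trace_galoisRepTorsion_frobenius_eq`, Serre's (238)); and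
  `σ` fixes the value `ζ₀ = e_p(T₀, S₀) ≠ 1` of a Weil pairing (`exists_weilPairing_holds`, Galois equivariance + non-degeneracy), while
  `σ ζ₀ = ζ₀^ℓ` (`smul_eq_pow_residueCard_of_isArithFrobAt`), so `ζ₀^{ℓ−1} = 1` and `p ∣ ℓ − 1`; hence also `p ∣ a_ℓ − (ℓ + 1)`.
* `exists_kuriharaLevel_prime_gt` — so a PRIME Kurihara level `n = ℓ > b` exists (`IsKuriharaLevel W p ℓ` unfolded: square-free,
  `> 1`, every prime factor a Kurihara prime).
* `exists_kuriharaLevel_card_eq` — and Kurihara levels with ANY prescribed number `k ≥ 1` of prime factors, all above any bound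
  (induction: multiply by a fresh Kurihara prime above the current level).

HONEST FRAMING: E-side, unconditional, elementary given the tree's Čebotarev theorem; the card's residual (a UNIT Kurihara number at
some level) is untouched.  References (locators only): [cite: KimNakamura2020, §1.2 (Kurihara primes), Rem. 1.8]
[cite: Serre1981, §8.1 eq. (238)] [cite: SerreAbelianLadic1968, Ch. I §2.2, Cor. 2 (a)].
-/

-- single-conjunct summit: `Summit.BirchSwinnertonDyer.BirchSwinnertonDyer.…` repeats the name by design
set_option linter.dupNamespace false
set_option autoImplicit false

noncomputable section

open scoped Classical NumberField

namespace Summit.BirchSwinnertonDyer.BirchSwinnertonDyer.Theorems.AdditiveKoly.KuriharaRoad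

open WeierstrassCurve NumberField IsDedekindDomain Field Rat.HeightOneSpectrum
  Literature.NumberTheory.EllipticCurves Literature.NumberTheory.GaloisRepresentations

variable (W : WeierstrassCurve ℚ) [W.IsElliptic] [W.IsGloballyMinimal] (p : ℕ) [hp : Fact p.Prime]

/-! ## §1 One Kurihara prime above every bound -/

/-- **KURIHARA PRIMES EXIST ABOVE EVERY BOUND** (for every elliptic `W/ℚ` in global minimal form and every prime `p`): for every `b`
there is a prime `ℓ > b` with `ℓ ∤ N_W`, `ℓ ≠ p`, `p ∣ ℓ − 1` and `p ∣ a_ℓ(W) − (ℓ + 1)` — the clauses of the card's `IsKuriharaLevel`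
at a prime.  Čebotarev for the identity class of `Gal(ℚ(E[p])/ℚ)`: an arithmetic Frobenius in `Γ_{ℚ(E[p])}` above a large `ℓ` has
trace `2` on `E[p]` (so `a_ℓ ≡ 2`) and fixes a non-trivial value of the Weil pairing, a primitive `p`-th root of unity `ζ₀`, while
raising it to the `ℓ`-th power (so `ℓ ≡ 1`).  No hypothesis on the image of `ρ̄_{E,p}`.
[cite: KimNakamura2020, §1.2 (Kurihara primes)] [cite: Serre1981, §8.1 eq. (238)] [cite: SerreAbelianLadic1968, Ch. I §2.2, Cor. 2 (a)] -/
theorem exists_kuriharaPrime_gt (b : ℕ) :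
    ∃ ℓ : ℕ, b < ℓ ∧ ℓ.Prime ∧ ¬ (ℓ : ℤ) ∣ (W.conductorNorm ℤ : ℤ) ∧ ℓ ≠ p ∧ p ∣ ℓ - 1 ∧
      (p : ℤ) ∣ W.frobeniusTrace ℓ - (ℓ + 1) := by
  have hpP : p.Prime := hp.out
  have hp0 : ((p : ℕ) : ℤ) ≠ 0 := by exact_mod_cast hpP.ne_zero
  -- the finite set of small places
  set B : ℕ := max b (max (W.conductorNorm ℤ) p) with hB
  set S : Set (HeightOneSpectrum (𝓞 ℚ)) := {v | ((primesEquiv v : Nat.Primes) : ℕ) ≤ B} with hSdef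
  have hS : S.Finite := by
    refine ((Set.finite_Iic B).preimage (f := fun v : HeightOneSpectrum (𝓞 ℚ) ↦ ((primesEquiv v : Nat.Primes) : ℕ))
      fun v _ w _ h ↦ primesEquiv.injective (Subtype.ext h)).subset ?_
    intro v hv
    exact hv
  -- Čebotarev: an arithmetic Frobenius outside `S` inside the open subgroup `Γ_{ℚ(E[p])}`
  have hdense := absoluteGaloisGroup.frobenius_dense Literature.NumberTheory.Automorphic.chebotarev_artinRep_holds ℚ S hS
  have hopen : IsOpen (torsionFixing W (p : ℤ) : Set (absoluteGaloisGroup ℚ)) := isOpen_torsionFixing W hp0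
  obtain ⟨σ, hσT, w, hwS, 𝔓, h𝔓, hσ⟩ := hdense.inter_open_nonempty _ hopen ⟨1, (torsionFixing W (p : ℤ)).one_mem⟩
  have hσT' : σ ∈ torsionFixing W (p : ℤ) := hσT
  -- the rational prime `ℓ` under `w`
  set ℓ : ℕ := ((primesEquiv w : Nat.Primes) : ℕ) with hℓdef
  have hℓ : ℓ.Prime := (primesEquiv w).2
  haveI : Fact ℓ.Prime := ⟨hℓ⟩
  have hBℓ : B < ℓ := by
    by_contra h
    exact hwS (not_lt.mp h)
  have hbℓ : b < ℓ := lt_of_le_of_lt (le_max_left _ _) hBℓ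
  have hNℓ : W.conductorNorm ℤ < ℓ := lt_of_le_of_lt ((le_max_left _ _).trans (le_max_right _ _)) hBℓ
  have hpℓ : p < ℓ := lt_of_le_of_lt ((le_max_right _ _).trans (le_max_right _ _)) hBℓ
  have hℓp : ℓ ≠ p := hpℓ.ne'
  have hℓN : ¬ ℓ ∣ W.conductorNorm ℤ := fun h ↦
    absurd (Nat.le_of_dvd W.conductorNorm_pos_holds h) (not_le.mpr hNℓ)
  have hgood : W.HasGoodReductionAtPrime ℓ := by
    by_contra h
    exact hℓN ((W.dvd_conductorNorm_iff_not_hasGoodReductionAtPrime ℓ).mpr h)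
  have hℓw : (ℓ : 𝓞 ℚ) ∈ w.asIdeal := by
    rw [natCast_mem_asIdeal_iff_eq_primesEquiv_symm w hℓ]
    rw [show (⟨ℓ, hℓ⟩ : Nat.Primes) = primesEquiv w from Subtype.ext rfl, Equiv.symm_apply_apply]
  -- (1) the trace: `a_ℓ ≡ 2 (mod p)`
  letI : Module (ZMod p) (geomTorsion W p) := AddSubgroup.torsionBy.zmodModule
  have htr := W.trace_galoisRepTorsion_frobenius_eq p hℓp hgood (v := w) rfl h𝔓 hσ
  have hid : (galoisRepTorsion W p σ).toAdd.toAddMonoidHom.toZModLinearMap p = LinearMap.id := by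
    refine LinearMap.ext fun P ↦ ?_
    change (galoisRepTorsion W p σ).toAdd P = P
    rw [galoisRepTorsion_apply]
    exact smul_eq_of_mem_torsionFixing W _ hσT' P
  haveI hfin : Finite (geomTorsion W (p : ℤ)) := finite_torsionPoints_holds W (AlgebraicClosure ℚ) hp0
  have hcard : Nat.card (geomTorsion W (p : ℤ)) = p ^ 2 :=
    card_torsionPoints_eq_sq_holds W (AlgebraicClosure ℚ) (by exact_mod_cast hpP.ne_zero)
  haveI : Module.Finite (ZMod p) (geomTorsion W (p : ℤ)) := Module.Finite.of_finite
  have hrank : Module.finrank (ZMod p) (geomTorsion W (p : ℤ)) = 2 := by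
    have h := Module.natCard_eq_pow_finrank (K := ZMod p) (V := geomTorsion W (p : ℤ))
    rw [hcard, Nat.card_zmod] at h
    exact (Nat.pow_right_injective hpP.two_le h).symm
  rw [hid, LinearMap.trace_id, hrank] at htr
  have h2 : ((W.frobeniusTrace ℓ : ℤ) : ZMod p) = ((2 : ℤ) : ZMod p) := by
    rw [← htr]; push_cast; rfl
  have hdvd2 : (p : ℤ) ∣ W.frobeniusTrace ℓ - 2 :=
    dvd_sub_comm.mp ((ZMod.intCast_eq_intCast_iff_dvd_sub _ _ _).mp h2)
  -- (2) the determinant: `σ` fixes a primitive `p`-th root of unity, and raises it to the `ℓ`-th power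
  obtain ⟨e, hpow, -, -, -, hnd, hgal⟩ := W.exists_weilPairing_holds p hpP.two_le (by exact_mod_cast hpP.ne_zero)
  obtain ⟨S₀, hS₀⟩ : ∃ S₀ : geomTorsion W (p : ℤ), S₀ ≠ 0 := by
    have h1 : 1 < Nat.card (geomTorsion W (p : ℤ)) := by
      rw [hcard]; exact Nat.one_lt_pow two_ne_zero hpP.one_lt
    obtain ⟨x, y, hxy⟩ := (Finite.one_lt_card_iff_nontrivial.mp h1).exists_pair_ne
    by_cases hx : x = 0
    · exact ⟨y, fun hy ↦ hxy (by rw [hx, hy])⟩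
    · exact ⟨x, hx⟩
  obtain ⟨T₀, hT₀⟩ : ∃ T₀, e T₀ S₀ ≠ 1 := by
    by_contra hall
    push Not at hall
    exact hS₀ (hnd S₀ hall)
  set ζ₀ := e T₀ S₀ with hζ₀
  have hζp : ζ₀ ^ p = 1 := hpow T₀ S₀
  have hfix : σ • ζ₀ = ζ₀ := by
    rw [hζ₀, hgal, smul_eq_of_mem_torsionFixing W _ hσT' T₀, smul_eq_of_mem_torsionFixing W _ hσT' S₀]
  have hpw : (p : 𝓞 ℚ) ∉ w.asIdeal := not_natCast_mem_of_prime_ne hℓ hpP hℓp w hℓw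
  have hfrob : σ • ζ₀ = ζ₀ ^ w.residueCard :=
    smul_eq_pow_residueCard_of_isArithFrobAt (ℓ := p) hpw h𝔓 hσ (n := 1) (by rw [pow_one]; exact hζp)
  rw [residueCard_eq_of_natCast_mem_rat hℓ hℓw, hfix] at hfrob
  have hζ0 : ζ₀ ≠ 0 := fun h ↦ by
    rw [h, zero_pow hpP.ne_zero] at hζp
    exact zero_ne_one hζp
  have hζℓ : ζ₀ ^ (ℓ - 1) = 1 := by
    have h1 : ζ₀ ^ (ℓ - 1) * ζ₀ = 1 * ζ₀ := by
      rw [pow_sub_one_mul hℓ.ne_zero, one_mul]; exact hfrob.symm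
    exact mul_right_cancel₀ hζ0 h1
  have hord : orderOf ζ₀ = p := orderOf_eq_prime hζp hT₀
  have hdvd1 : p ∣ ℓ - 1 := hord ▸ orderOf_dvd_of_pow_eq_one hζℓ
  -- assemble
  refine ⟨ℓ, hbℓ, hℓ, fun h ↦ hℓN (Int.natCast_dvd_natCast.mp h), hℓp, hdvd1, ?_⟩
  have hdvd1' : (p : ℤ) ∣ (ℓ : ℤ) - 1 := by
    have h := Int.natCast_dvd_natCast.mpr hdvd1
    rwa [Nat.cast_sub hℓ.one_le, Nat.cast_one] at h
  have : (W.frobeniusTrace ℓ - (ℓ + 1) : ℤ) = (W.frobeniusTrace ℓ - 2) - ((ℓ : ℤ) - 1) := by ring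
  rw [this]
  exact dvd_sub hdvd2 hdvd1'

/-! ## §2 Kurihara levels -/

/-- **A PRIME Kurihara level above every bound**: some prime `ℓ > b` is a Kurihara level of `(W, p)` — the card's `IsKuriharaLevel W p ℓ`
unfolded (square-free, `> 1`, every prime factor `ℓ′ ∣ ℓ` has `ℓ′ ∤ N_W`, `ℓ′ ≠ p`, `p ∣ ℓ′ − 1`, `p ∣ a_{ℓ′} − (ℓ′ + 1)`).
[cite: KimNakamura2020, §1.2 (Kurihara primes)] -/
theorem exists_kuriharaLevel_prime_gt (b : ℕ) :
    ∃ n : ℕ, b < n ∧ n.Prime ∧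
      (Squarefree n ∧ 1 < n ∧ ∀ ℓ ∈ n.primeFactors,
        ¬ (ℓ : ℤ) ∣ (W.conductorNorm ℤ : ℤ) ∧ ℓ ≠ p ∧ p ∣ ℓ - 1 ∧ (p : ℤ) ∣ W.frobeniusTrace ℓ - (ℓ + 1)) := by
  obtain ⟨ℓ, hbℓ, hℓ, hN, hℓp, h1, ha⟩ := exists_kuriharaPrime_gt W p b
  refine ⟨ℓ, hbℓ, hℓ, hℓ.squarefree, hℓ.one_lt, fun q hq ↦ ?_⟩
  rw [hℓ.primeFactors, Finset.mem_singleton] at hq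
  subst hq
  exact ⟨hN, hℓp, h1, ha⟩

/-- **Kurihara levels with any prescribed number of prime factors, all above any bound.**  For every `k ≥ 1` and `b` there is a
square-free `n > 1` with exactly `k` prime factors, all `> b`, each a Kurihara prime of `(W, p)`; in particular `n` is a Kurihara level
(`IsKuriharaLevel W p n` unfolded).  Induction on `k`, multiplying by a fresh Kurihara prime above the current level.
[cite: KimNakamura2020, §1.2 (Kurihara primes), Rem. 1.8] -/
theorem exists_kuriharaLevel_card_eq (k : ℕ) (hk : 1 ≤ k) (b : ℕ) :
    ∃ n : ℕ, n.primeFactors.card = k ∧ (∀ ℓ ∈ n.primeFactors, b < ℓ) ∧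
      (Squarefree n ∧ 1 < n ∧ ∀ ℓ ∈ n.primeFactors,
        ¬ (ℓ : ℤ) ∣ (W.conductorNorm ℤ : ℤ) ∧ ℓ ≠ p ∧ p ∣ ℓ - 1 ∧ (p : ℤ) ∣ W.frobeniusTrace ℓ - (ℓ + 1)) := by
  induction k, hk using Nat.le_induction with
  | base =>
    obtain ⟨ℓ, hbℓ, hℓ, hK⟩ := exists_kuriharaLevel_prime_gt W p b
    refine ⟨ℓ, by rw [hℓ.primeFactors, Finset.card_singleton], fun q hq ↦ ?_, hK⟩
    rw [hℓ.primeFactors, Finset.mem_singleton] at hq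
    rw [hq]; exact hbℓ
  | succ k hk ih =>
    obtain ⟨n, hcard, hbig, hsq, hn1, hK⟩ := ih
    obtain ⟨ℓ, hbℓ, hℓ, hN, hℓp, h1, ha⟩ := exists_kuriharaPrime_gt W p (max b n)
    have hbℓ' : b < ℓ := lt_of_le_of_lt (le_max_left _ _) hbℓ
    have hnℓ : n < ℓ := lt_of_le_of_lt (le_max_right _ _) hbℓ
    have hℓn : ¬ ℓ ∣ n := fun h ↦ absurd (Nat.le_of_dvd (by omega) h) (not_le.mpr hnℓ)
    have hcop : Nat.Coprime ℓ n := (Nat.Prime.coprime_iff_not_dvd hℓ).mpr hℓn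
    have hn0 : n ≠ 0 := by omega
    have hpf : (ℓ * n).primeFactors = insert ℓ n.primeFactors := by
      rw [Nat.primeFactors_mul hℓ.ne_zero hn0, hℓ.primeFactors]
      rfl
    have hℓmem : ℓ ∉ n.primeFactors := fun h ↦ hℓn (Nat.dvd_of_mem_primeFactors h)
    refine ⟨ℓ * n, ?_, ?_, ?_, ?_, ?_⟩
    · rw [hpf, Finset.card_insert_of_notMem hℓmem, hcard]
    · intro q hq
      rw [hpf, Finset.mem_insert] at hq
      rcases hq with rfl | hq
      · exact hbℓ'
      · exact hbig q hq
    · exact (Nat.squarefree_mul hcop).mpr ⟨hℓ.squarefree, hsq⟩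
    · exact one_lt_mul'' hℓ.one_lt hn1
    · intro q hq
      rw [hpf, Finset.mem_insert] at hq
      rcases hq with rfl | hq
      · exact ⟨hN, hℓp, h1, ha⟩
      · exact hK q hq

end Summit.BirchSwinnertonDyer.BirchSwinnertonDyer.Theorems.AdditiveKoly.KuriharaRoad

end
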